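import Mathlib

/-!
# Block sums of pair marginals (forced hits and hub masses)

Crux `Summit.MatrixMultiplication.MatrixMultiplication.Theses.SnSubsetDichotomy.PolynomialSlack`
(item `stmt-MatrixMultiplication-8306`), helper file of lead c6 (line `transport-split-hull`,
programme BEYOND ONE HALF). For `X, Y ⊆ S_n` the PAIR MARGINAL
`m_{XY}(i,j) = #{(x,y) ∈ X × Y : y j = x i}` counts the pairs whose quotient `x⁻¹y` maps `j ↦ i`
(tree file `…PolynomialSlackMarginals`). This file records the three block-count identities of the
programme, all obtained by fibring over the COMMON VALUE `v = x i = y j`: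

* `pairMarginal_eq_sum_mul_nat` — `m_{XY}(i,j) = Σ_v #{x : x i = v}·#{y : y j = v}` (in `ℕ`);
* `card_filter_inv_apply_mem` — `#{x ∈ X : x⁻¹ v ∈ I} = Σ_{i ∈ I} #{x ∈ X : x i = v}`;
* `sum_pairMarginal_block_eq` (FORCED HITS) —
  `Σ_{i ∈ I} Σ_{j ∈ J} m_{ST}(i,j) = Σ_v #{t : t⁻¹ v ∈ J}·#{s : s⁻¹ v ∈ I}`;
* `sum_pairMarginal_col_block_eq` — `Σ_{j ∈ J} m_{TU}(j,k) = Σ_v #{u : u k = v}·#{t : t⁻¹ v ∈ J}`;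
* `sum_pairMarginal_row_block_eq` — `Σ_{i ∈ I} m_{US}(k,i) = Σ_v #{u : u k = v}·#{s : s⁻¹ v ∈ I}`.
-/

namespace Summit.MatrixMultiplication.MatrixMultiplication.Theorems.PolynomialSlack

set_option linter.dupNamespace false

open scoped BigOperators

/-! ## Fibring over the common value -/

/-- The pair marginal factors over the common value (natural-number form):
`#{(x,y) ∈ X × Y : y j = x i} = Σ_v #{x ∈ X : x i = v}·#{y ∈ Y : y j = v}`. [folklore] -/
theorem pairMarginal_eq_sum_mul_nat {n : ℕ} (X Y : Finset (Equiv.Perm (Fin n))) (i j : Fin n) :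
    ((X ×ˢ Y).filter fun xy => xy.2 j = xy.1 i).card =
      ∑ v : Fin n, (X.filter fun x => x i = v).card * (Y.filter fun y => y j = v).card := by
  classical
  rw [Finset.card_eq_sum_card_fiberwise
    (f := fun xy : Equiv.Perm (Fin n) × Equiv.Perm (Fin n) => xy.1 i)
    (s := (X ×ˢ Y).filter fun xy => xy.2 j = xy.1 i) (t := Finset.univ)
    (fun _ _ => Finset.mem_univ _)]
  refine Finset.sum_congr rfl fun v _ => ?_
  rw [← Finset.card_product]
  congr 1
  ext ⟨x, y⟩
  simp only [Finset.mem_filter, Finset.mem_product]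
  constructor
  · rintro ⟨⟨⟨hx, hy⟩, h1⟩, h2⟩
    exact ⟨⟨hx, h2⟩, hy, by rw [h1, h2]⟩
  · rintro ⟨⟨hx, h2⟩, hy, h1⟩
    exact ⟨⟨⟨hx, hy⟩, by rw [h1, h2]⟩, h2⟩

/-- Fibring the preimage condition over the position: `#{x ∈ X : x⁻¹ v ∈ I} = Σ_{i ∈ I} #{x ∈ X : x i = v}`
(the fibre of `x ↦ x⁻¹ v` over `i` is `{x : x i = v}`). [folklore] -/
theorem card_filter_inv_apply_mem {n : ℕ} (X : Finset (Equiv.Perm (Fin n))) (I : Finset (Fin n))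
    (v : Fin n) :
    (X.filter fun x => x⁻¹ v ∈ I).card = ∑ i ∈ I, (X.filter fun x => x i = v).card := by
  classical
  rw [Finset.card_eq_sum_card_fiberwise (f := fun x : Equiv.Perm (Fin n) => x⁻¹ v)
    (s := X.filter fun x => x⁻¹ v ∈ I) (t := I) (fun x hx => (Finset.mem_filter.1 hx).2)]
  refine Finset.sum_congr rfl fun i hi => ?_
  congr 1
  ext x
  simp only [Finset.mem_filter, Equiv.Perm.inv_eq_iff_eq]
  constructor
  · rintro ⟨⟨hx, _⟩, h⟩
    exact ⟨hx, h.symm⟩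
  · rintro ⟨hx, h⟩
    refine ⟨⟨hx, ?_⟩, h.symm⟩
    have hxi : x⁻¹ v = i := Equiv.Perm.inv_eq_iff_eq.2 h.symm
    rw [hxi]
    exact hi

/-! ## The three block-count identities -/

/-- **Forced hits.** Summing the pair marginal `m_{ST}(i,j) = #{(s,t) ∈ S × T : t j = s i}` over a
block `I × J` counts, value by value, the pairs sending the value into the block:
`Σ_{i ∈ I} Σ_{j ∈ J} m_{ST}(i,j) = Σ_v #{t ∈ T : t⁻¹ v ∈ J}·#{s ∈ S : s⁻¹ v ∈ I}`. [folklore] -/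
theorem sum_pairMarginal_block_eq {n : ℕ} (S T : Finset (Equiv.Perm (Fin n))) (I J : Finset (Fin n)) :
    ∑ i ∈ I, ∑ j ∈ J, ((S ×ˢ T).filter fun st => st.2 j = st.1 i).card =
      ∑ v : Fin n, (T.filter fun t => t⁻¹ v ∈ J).card * (S.filter fun s => s⁻¹ v ∈ I).card := by
  classical
  calc ∑ i ∈ I, ∑ j ∈ J, ((S ×ˢ T).filter fun st => st.2 j = st.1 i).card
      = ∑ i ∈ I, ∑ j ∈ J, ∑ v : Fin n,
          (S.filter fun s => s i = v).card * (T.filter fun t => t j = v).card := by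
        simp_rw [pairMarginal_eq_sum_mul_nat]
    _ = ∑ i ∈ I, ∑ v : Fin n, ∑ j ∈ J,
          (S.filter fun s => s i = v).card * (T.filter fun t => t j = v).card :=
        Finset.sum_congr rfl fun _ _ => Finset.sum_comm
    _ = ∑ v : Fin n, ∑ i ∈ I, ∑ j ∈ J,
          (S.filter fun s => s i = v).card * (T.filter fun t => t j = v).card := Finset.sum_comm
    _ = ∑ v : Fin n, (∑ j ∈ J, (T.filter fun t => t j = v).card) *
          (∑ i ∈ I, (S.filter fun s => s i = v).card) := by
        refine Finset.sum_congr rfl fun v _ => ?_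
        rw [Finset.sum_mul_sum, Finset.sum_comm]
        refine Finset.sum_congr rfl fun i _ => Finset.sum_congr rfl fun j _ => ?_
        rw [mul_comm]
    _ = ∑ v : Fin n, (T.filter fun t => t⁻¹ v ∈ J).card * (S.filter fun s => s⁻¹ v ∈ I).card := by
        simp_rw [card_filter_inv_apply_mem]

/-- **Hub column mass.** `Σ_{j ∈ J} m_{TU}(j,k) = Σ_v #{u ∈ U : u k = v}·#{t ∈ T : t⁻¹ v ∈ J}`
(`m_{TU}(j,k) = #{(t,u) ∈ T × U : u k = t j}`; fibre over the common value `v = u k`). [folklore] -/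
theorem sum_pairMarginal_col_block_eq {n : ℕ} (T U : Finset (Equiv.Perm (Fin n))) (J : Finset (Fin n))
    (k : Fin n) :
    ∑ j ∈ J, ((T ×ˢ U).filter fun tu => tu.2 k = tu.1 j).card =
      ∑ v : Fin n, (U.filter fun u => u k = v).card * (T.filter fun t => t⁻¹ v ∈ J).card := by
  classical
  calc ∑ j ∈ J, ((T ×ˢ U).filter fun tu => tu.2 k = tu.1 j).card
      = ∑ j ∈ J, ∑ v : Fin n, (T.filter fun t => t j = v).card * (U.filter fun u => u k = v).card := by
        simp_rw [pairMarginal_eq_sum_mul_nat]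
    _ = ∑ v : Fin n, ∑ j ∈ J, (T.filter fun t => t j = v).card * (U.filter fun u => u k = v).card :=
        Finset.sum_comm
    _ = ∑ v : Fin n, (U.filter fun u => u k = v).card * ∑ j ∈ J, (T.filter fun t => t j = v).card := by
        refine Finset.sum_congr rfl fun v _ => ?_
        rw [Finset.mul_sum]
        refine Finset.sum_congr rfl fun j _ => ?_
        rw [mul_comm]
    _ = ∑ v : Fin n, (U.filter fun u => u k = v).card * (T.filter fun t => t⁻¹ v ∈ J).card := by
        simp_rw [card_filter_inv_apply_mem]

/-- **Hub row mass.** `Σ_{i ∈ I} m_{US}(k,i) = Σ_v #{u ∈ U : u k = v}·#{s ∈ S : s⁻¹ v ∈ I}`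
(`m_{US}(k,i) = #{(u,s) ∈ U × S : s i = u k}`; fibre over the common value `v = u k`). [folklore] -/
theorem sum_pairMarginal_row_block_eq {n : ℕ} (U S : Finset (Equiv.Perm (Fin n))) (I : Finset (Fin n))
    (k : Fin n) :
    ∑ i ∈ I, ((U ×ˢ S).filter fun us => us.2 i = us.1 k).card =
      ∑ v : Fin n, (U.filter fun u => u k = v).card * (S.filter fun s => s⁻¹ v ∈ I).card := by
  classical
  calc ∑ i ∈ I, ((U ×ˢ S).filter fun us => us.2 i = us.1 k).card
      = ∑ i ∈ I, ∑ v : Fin n, (U.filter fun u => u k = v).card * (S.filter fun s => s i = v).card := by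
        simp_rw [pairMarginal_eq_sum_mul_nat]
    _ = ∑ v : Fin n, ∑ i ∈ I, (U.filter fun u => u k = v).card * (S.filter fun s => s i = v).card :=
        Finset.sum_comm
    _ = ∑ v : Fin n, (U.filter fun u => u k = v).card * ∑ i ∈ I, (S.filter fun s => s i = v).card := by
        refine Finset.sum_congr rfl fun v _ => ?_
        rw [Finset.mul_sum]
    _ = ∑ v : Fin n, (U.filter fun u => u k = v).card * (S.filter fun s => s⁻¹ v ∈ I).card := by
        simp_rw [card_filter_inv_apply_mem]

end Summit.MatrixMultiplication.MatrixMultiplication.Theorems.PolynomialSlack
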